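import Summits.SmoothPoincare4.SmoothPoincare4.Theses.SymplecticOrigami
import Literature.Geometry.Symplectic.GromovMcDuffChartFormRelEnd
import Literature.Geometry.Symplectic.GromovR4RelEnd
import Summits.SmoothPoincare4.SmoothPoincare4.Theorems.SymplecticOrigamiOrigamiFoldExistenceHelperPuncturedGluedForm
import Summits.SmoothPoincare4.SmoothPoincare4.Theorems.SymplecticOrigamiOrigamiFoldExistenceHelperPuncturedChartBallEndPackage
import Summits.SmoothPoincare4.SmoothPoincare4.Theorems.SymplecticOrigamiOrigamiFoldExistenceHelperSphereOfDiffeomorphPunctured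
import Summits.SmoothPoincare4.SmoothPoincare4.Theorems.SymplecticOrigamiOrigamiFoldExistenceHelperRoundSeamHypothesesInhabited
import Literature.Topology.FourManifolds.HomotopySpheres
import Literature.Topology.FourManifolds.HomotopyS4CompactProofs
import Literature.Topology.FourManifolds.HomotopyS4OrientableProofs
import Summits.SmoothPoincare4.SmoothPoincare4.Theorems.SymplecticOrigamiOrigamiFoldExistenceStubChartEmbedding
import Literature.Topology.FourManifolds.GluckTwist
import Literature.Geometry.Kaehler.ComplexProjectiveSpaceFubiniStudy

/-!
# Line `stable-seam-host` (crux `OrigamiFoldExistence`, stmt-SmoothPoincare4-7844): THE ROUND-SEAM RUNG OF STUB 3 ⇐ `GromovRecognitionRelEnd`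

Lead c11, cycle 2.  STUB 3 of the line (`stub_stableSeamRigidity`: a homotopy 4-sphere whose fake
ball sits in a rational symplectic host with Ω-STABLE seam is `S⁴`) has a KNOWN RUNG in print — the
same with a CONTACT-TYPE seam (Gromov 1985, Eliashberg 1990, McDuff 1990) — whose innermost case is
the ROUND seam: in the chart `e` the seam GERM of `J` is that of a round sphere of `(ℝ⁴, ω₀)` seen
from infinity, `(J ∘ e)^*Ω = κ² · (A ∘ ι)^*ω_std` on an annulus `1 - δ < ‖y‖ < 1 + δ` (`ι(z) = z/‖z‖²`,
`A` a linear isometry, `κ > 0`).  This file reduces that rung, IN THE KERNEL, to the route's filed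
support item `GromovRecognitionRelEnd` (stmt-SmoothPoincare4-11009 = the audited Literature named
fact `gromov_recognitionR4_relEnd`, McDuff–Salamon 2017 Rem. 4.5.2 (viii), BY NAME):

* `helper_roundSeamRigidity_of_gromovRecognitionRelEnd` — `GromovRecognitionRelEnd →` [the binders and
  hypotheses of STUB 3, the stabilising form replaced by the ROUND germ] `→ S ≅ S⁴`.  Proof: shrink the
  annulus into `J`'s good open set (`exists_annulus_mapsTo`); on the punctured sphere `M := S ∖ {e 0}`
  take the coordinate at infinity `ψ := κ • A ∘ ι ∘ e⁻¹` on the punctured chart ball with its inverse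
  `χ` and the compactness / bijectivity clauses of Gromov's theorem (brick R2,
  `helper_puncturedChartBall_endPackage`); read in the chart, `D(ψ ∘ e) = κ • A ∘ Dι`, so ROUND says
  that `J^*Ω` and `ψ^*ω_std` AGREE on the collar `e({1 - δ < ‖y‖ < 1})`; glue them into one symplectic
  form `sf` on `M` (brick R1, `helper_puncturedGluedForm`, via the generic `helper_glue_closedForms`);
  `M` is path connected with `π₂(M) = 0` (tree: general position in the homotopy 4-sphere), so Gromov's
  theorem gives `Φ : M ≃ₘ ℝ⁴` equal to `ψ` off a compact set, hence (`exists_ball_disjoint_of_isCompact`)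
  `Φ ∘ e = κ • A ∘ ι` on a punctured ball; two discs glued by the identity then present `S` as the
  untwisted double `D⁴ ∪_id D⁴ ≅ S⁴` (brick R3, `helper_sphere_of_diffeomorph_punctured_chartBall`,
  Hirsch 8.2.1 — Cerf-free, Palais-free).
* rider `helper_smoothPoincare4_of_hostEmbedding_roundSeam` — THE ROUND RUNG OF THE WHOLE LINE:
  `GromovRecognitionRelEnd → STUB 1 → RoundSeam → SmoothPoincare4`, where `RoundSeam` is `StableSeam`
  with "stabilised seam trace" replaced by "round seam germ".  So the line's ladder reads, bottom to
  top: ROUND seam (this file: ⇐ stmt-11009, formal debt only) ⊂ CONTACT-TYPE seam (print: + Eliashberg's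
  uniqueness of the tight `S³` and a Liouville collar) ⊂ STABLE seam (STUB 3, research: finite-energy
  foliations for stable Hamiltonian `S³`).  `RoundSeam` itself is SPC4-true on paper (Darboux chart +
  disc theorem) but its kernel shield would need Darboux's theorem, not in the tree — it is a RUNG, not
  a registered stub.
No definitions, no named facts beyond the hypothesis `GromovRecognitionRelEnd`, no `sorry`.
-/

noncomputable section

-- the prescribed namespace `Summit.<P>.<Sub>.…` duplicates `SmoothPoincare4` (P = Sub)
set_option linter.dupNamespace false

open scoped Manifold ContDiff Topology RealInnerProductSpace
open Set Function Metric

namespace Summit.SmoothPoincare4.SmoothPoincare4.Theorems.OrigamiFoldExistence.StableSeamHost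

open Literature.Topology.FourManifolds (HomotopySphere)
open Literature.Geometry.Symplectic (punctured inversion stdSymplecticForm)

/-- **Annulus lemma** (topology): if `U ⊇ (e '' B̊⁴)ᶜ` is open and `e : ℝ⁴ → S` is an injective
continuous map, then `e` maps a whole neighbourhood `{1 - δ₁ < ‖y‖}` of the closed exterior into
`U`, with `δ₁ ≤ δ` prescribed. [folklore] -/
theorem exists_annulus_mapsTo {S : Type} [TopologicalSpace S] {e : EuclideanSpace ℝ (Fin 4) → S}
    (he : Continuous e) (hinj : Injective e) {U : Set S} (hU : IsOpen U)
    (hΔ : (e '' ball (0 : EuclideanSpace ℝ (Fin 4)) 1)ᶜ ⊆ U) {δ : ℝ} (hδ : 0 < δ) :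
    ∃ δ₁ : ℝ, 0 < δ₁ ∧ δ₁ ≤ δ ∧ δ₁ ≤ 1 / 2 ∧ ∀ y : EuclideanSpace ℝ (Fin 4), 1 - δ₁ < ‖y‖ → e y ∈ U := by
  -- points of norm ≥ 1 go to `U`
  have hout : ∀ y : EuclideanSpace ℝ (Fin 4), 1 ≤ ‖y‖ → e y ∈ U := by
    intro y hy
    refine hΔ ?_
    rintro ⟨z, hz, hzy⟩
    rw [hinj hzy] at hz
    exact (not_lt.2 hy) (by simpa using hz)
  -- the bad set inside the closed shell `1/2 ≤ ‖y‖ ≤ 1`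
  set C : Set (EuclideanSpace ℝ (Fin 4)) :=
    (closedBall 0 1 ∩ (ball 0 (1 / 2))ᶜ) ∩ (e ⁻¹' U)ᶜ with hC
  have hCc : IsCompact C :=
    ((isCompact_closedBall _ _).inter_right isOpen_ball.isClosed_compl).inter_right
      (hU.preimage he).isClosed_compl
  by_cases hCe : C = ∅
  · refine ⟨min δ (1 / 2), lt_min hδ (by norm_num), min_le_left _ _, min_le_right _ _, fun y hy => ?_⟩
    by_cases h1 : 1 ≤ ‖y‖
    · exact hout y h1
    · by_contra hyU
      have : y ∈ C := by
        refine ⟨⟨?_, ?_⟩, hyU⟩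
        · simpa using (not_le.1 h1).le
        · have : (1 : ℝ) / 2 ≤ ‖y‖ := by
            have := min_le_right δ (1 / 2); linarith
          simpa using this
      rw [hCe] at this
      exact this
  · obtain ⟨y₀, hy₀C, hmax⟩ := hCc.exists_isMaxOn (Set.nonempty_iff_ne_empty.2 hCe)
      continuous_norm.continuousOn
    have hy₀lt : ‖y₀‖ < 1 := by
      rcases hy₀C with ⟨⟨h1, -⟩, h2⟩
      have h1' : ‖y₀‖ ≤ 1 := by simpa using h1
      rcases h1'.lt_or_eq with h | h
      · exact h
      · exact absurd (hout y₀ h.ge) h2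
    have hy₀half : (1 : ℝ) / 2 ≤ ‖y₀‖ := by
      rcases hy₀C with ⟨⟨-, h2⟩, -⟩
      simpa using h2
    refine ⟨min δ (1 - ‖y₀‖), lt_min hδ (by linarith), min_le_left _ _,
      (min_le_right _ _).trans (by linarith), fun y hy => ?_⟩
    by_cases h1 : 1 ≤ ‖y‖
    · exact hout y h1
    · by_contra hyU
      have hy2 : (1 : ℝ) / 2 ≤ ‖y‖ := by
        have : 1 - ‖y₀‖ ≤ 1 / 2 + (1 / 2 - ‖y₀‖) := by linarith
        rcases hy₀C with ⟨⟨-, h2⟩, -⟩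
        have h2' : (1 : ℝ) / 2 ≤ ‖y₀‖ := by simpa using h2
        have := min_le_right δ (1 - ‖y₀‖)
        linarith
      have hyC : y ∈ C := ⟨⟨by simpa using (not_le.1 h1).le, by simpa using hy2⟩, hyU⟩
      have hle : ‖y‖ ≤ ‖y₀‖ := hmax hyC
      have := min_le_right δ (1 - ‖y₀‖)
      linarith

/-- **Puncture lemma** (topology): a compact subset `K'` of the punctured manifold `S ∖ {e 0}`
misses a whole punctured chart ball `e(B(0, ρ)) ∖ {e 0}`. [folklore] -/
theorem exists_ball_disjoint_of_isCompact {S : Type} [TopologicalSpace S] [T2Space S]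
    {e : EuclideanSpace ℝ (Fin 4) → S} (he : Continuous e)
    {K' : Set (punctured (e 0))} (hK : IsCompact K') :
    ∃ ρ : ℝ, 0 < ρ ∧ ∀ (x : punctured (e 0)) (y : EuclideanSpace ℝ (Fin 4)),
      x.1 = e y → ‖y‖ < ρ → x ∉ K' := by
  have hKc : IsCompact (Subtype.val '' K' : Set S) := hK.image continuous_subtype_val
  have hp : e 0 ∉ (Subtype.val '' K' : Set S) := by
    rintro ⟨x, -, hx⟩
    exact (Literature.Geometry.Symplectic.mem_punctured.1 x.2) hx
  have hopen : IsOpen ((Subtype.val '' K' : Set S)ᶜ) := hKc.isClosed.isOpen_compl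
  have h0 : (0 : EuclideanSpace ℝ (Fin 4)) ∈ e ⁻¹' (Subtype.val '' K' : Set S)ᶜ := hp
  obtain ⟨ρ, hρ, hball⟩ := Metric.isOpen_iff.1 (hopen.preimage he) 0 h0
  refine ⟨ρ, hρ, fun x y hxy hy hxK => ?_⟩
  have : e y ∈ (Subtype.val '' K' : Set S) := ⟨x, hxK, hxy⟩
  exact hball (by simpa using hy) this

/-- **THE ROUND-SEAM RUNG OF STUB 3 ⇐ `GromovRecognitionRelEnd`.**  Under Gromov's recognition of
`(ℝ⁴, ω₀)` relative to a standard end (route item stmt-SmoothPoincare4-11009, by name): if the fake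
ball of a homotopy 4-sphere `S` (cut along the chart ball `e`) sits via `J` in a symplectic
`ℝ⁴`-charted `(X, Ω)` (the rational-host clause is carried, not used) and the seam germ is ROUND in
the chart — `(J ∘ e)^*Ω = κ² (A ∘ ι)^*ω_std` on an annulus about the unit sphere — then `S ≅ S⁴`.
[cite: McDuffSalamon2017, Rem. 4.5.2 (viii)] [cite: Gromov1985, §0.3.C] -/
theorem helper_roundSeamRigidity_of_gromovRecognitionRelEnd :
    Summit.SmoothPoincare4.SmoothPoincare4.Theses.SymplecticOrigami.GromovRecognitionRelEnd → ∀ (S : Literature.Topology.FourManifolds.HomotopySphere 4) (e : EuclideanSpace ℝ (Fin 4) → S.carrier) (X : Type) [TopologicalSpace X] [T2Space X] [SecondCountableTopology X] [CompactSpace X] [ChartedSpace (EuclideanSpace ℝ (Fin 4)) X] [IsManifold (𝓡 4) ∞ X] [SimplyConnectedSpace X] (Ω : Literature.Geometry.Kaehler.MForm (𝓡 4) X ℝ 2) (J : S.carrier → X), Manifold.IsSmoothEmbedding (𝓡 4) (𝓡 4) ∞ e → (Literature.Geometry.Kaehler.IsSmoothForm Ω ∧ Literature.Geometry.Kaehler.IsClosedForm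 Ω ∧ ∀ x (v : TangentSpace (𝓡 4) x), v ≠ 0 → ∃ w, Ω x ![v, w] ≠ 0) → (∃ U : Set S.carrier, IsOpen U ∧ (e '' Metric.ball (0 : EuclideanSpace ℝ (Fin 4)) 1)ᶜ ⊆ U ∧ ContMDiffOn (𝓡 4) (𝓡 4) ∞ J U ∧ Set.InjOn J U ∧ ∀ x ∈ U, Function.Bijective (mfderiv (𝓡 4) (𝓡 4) J x)) → ((∃ c c' : (Metric.sphere (0 : EuclideanSpace ℝ (Fin 3)) 1) → X, (Manifold.IsSmoothEmbedding (𝓡 2) (𝓡 4) ∞ c ∧ (∀ y (v : TangentSpace (𝓡 2) y), v ≠ 0 → ∃ w : TangentSpace (𝓡 2) y, Ω (c y) ![mfderiv (𝓡 2) (𝓡 4) c y v, mfderiv (𝓡 2) (𝓡 4) c y w] ≠ 0) ∧ Manifold.IsSmoothEmbedding (𝓡 2) (𝓡 4) ∞ c' ∧ Disjoint (Set.range c) (Set.range c') ∧ ∃ H : unitInterval × (Metric.sphere (0 : EuclideanSpace ℝ (Fin 3)) 1) → X, Continuous H ∧ ∀ y, H (0, y) = c y ∧ H (1, y) = c' y))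 ∨ (∃ (Ψ : X ≃ₘ⟮𝓡 4, 𝓡 4⟯ Literature.Topology.FourManifolds.ComplexProjectivePlane) (a : ℝ), 0 < a ∧ ∀ x (v w : TangentSpace (𝓡 4) x), Ω x ![v, w] = a * Literature.Geometry.Kaehler.CPn.fsForm 2 (Ψ x) ![mfderiv (𝓡 4) (𝓡 4) Ψ x v, mfderiv (𝓡 4) (𝓡 4) Ψ x w])) → (∃ (κ : ℝ) (A : EuclideanSpace ℝ (Fin 4) ≃ₗᵢ[ℝ] EuclideanSpace ℝ (Fin 4)) (δ : ℝ), 0 < κ ∧ 0 < δ ∧ ∀ y : EuclideanSpace ℝ (Fin 4), 1 - δ < ‖y‖ → ‖y‖ < 1 + δ → ∀ v w : EuclideanSpace ℝ (Fin 4), Ω ((J ∘ e) y) ![mfderiv (𝓡 4) (𝓡 4) (J ∘ e) y v, mfderiv (𝓡 4) (𝓡 4) (J ∘ e) y w] = κ ^ 2 * Literature.Geometry.Symplectic.stdSymplecticForm (A (fderiv ℝ Literature.Geometry.Symplectic.inversion y v)) (A (fderiv ℝ Literature.Geometry.Symplectic.inversion y w))) → Nonempty (S.carrier ≃ₘ⟮𝓡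 4, 𝓡 4⟯ Metric.sphere (0 : EuclideanSpace ℝ (Fin 5)) 1) := by
  intro hG S e X _ _ _ _ _ _ _ Ω J he hΩ hJ _hX hround
  obtain ⟨κ, A, δ, hκ, hδ, hR⟩ := hround
  obtain ⟨U, hUo, hΔU, hJU, -, hJbij⟩ := hJ
  -- shrink the annulus into `U`
  obtain ⟨δ₁, hδ₁, hδ₁δ, hδ₁h, hann⟩ :=
    exists_annulus_mapsTo he.contMDiff.continuous he.isEmbedding.injective hUo hΔU hδ
  -- the coordinate at infinity `ψ = κ • A ∘ ι ∘ e⁻¹` and its inverse (brick R2, `r₀ = 1`)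
  obtain ⟨ψt, χ, hψe, hψs, hψb, hcpt, hψK, hχ, hbij, hleft⟩ :=
    helper_puncturedChartBall_endPackage S.carrier e A κ 1 he hκ one_pos le_rfl
  -- (c) the coordinate at infinity read in the chart: `D(ψt ∘ e)_y = κ • A ∘ Dι_y` on `B̊ ∖ 0`
  have hψmf : ∀ y : EuclideanSpace ℝ (Fin 4), y ≠ 0 → ‖y‖ < 1 → ∀ v : EuclideanSpace ℝ (Fin 4),
      mfderiv (𝓡 4) 𝓘(ℝ, EuclideanSpace ℝ (Fin 4)) (ψt ∘ e) y v = κ • A (fderiv ℝ inversion y v) := by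
    intro y hy0 hy1 v
    set g : EuclideanSpace ℝ (Fin 4) → EuclideanSpace ℝ (Fin 4) :=
      fun z => κ • (A.toContinuousLinearEquiv : EuclideanSpace ℝ (Fin 4) →L[ℝ] EuclideanSpace ℝ (Fin 4))
        (inversion z) with hg
    have hev : (ψt ∘ e) =ᶠ[𝓝 y] g := by
      have hO : IsOpen (ball (0 : EuclideanSpace ℝ (Fin 4)) 1 \ {0}) :=
        isOpen_ball.sdiff isClosed_singleton
      filter_upwards [hO.mem_nhds ⟨by simpa using hy1, hy0⟩] with z hz
      have hz1 : ‖z‖ < 1 := by simpa using hz.1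
      simp only [hg, Function.comp_apply]
      exact hψe z hz.2 hz1
    rw [hev.mfderiv_eq, mfderiv_eq_fderiv]
    have hι : DifferentiableAt ℝ inversion y := Literature.Geometry.Symplectic.differentiableAt_inversion hy0
    have hAι : DifferentiableAt ℝ
        (fun z => (A.toContinuousLinearEquiv : EuclideanSpace ℝ (Fin 4) →L[ℝ] EuclideanSpace ℝ (Fin 4))
          (inversion z)) y :=
      (A.toContinuousLinearEquiv : EuclideanSpace ℝ (Fin 4) →L[ℝ]
        EuclideanSpace ℝ (Fin 4)).differentiableAt.comp y hι
    have h1 : fderiv ℝ g y = κ • fderiv ℝ (fun z => (A.toContinuousLinearEquiv :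
        EuclideanSpace ℝ (Fin 4) →L[ℝ] EuclideanSpace ℝ (Fin 4)) (inversion z)) y := by
      rw [hg]; exact fderiv_const_smul hAι κ
    have h2 : fderiv ℝ (fun z => (A.toContinuousLinearEquiv :
        EuclideanSpace ℝ (Fin 4) →L[ℝ] EuclideanSpace ℝ (Fin 4)) (inversion z)) y =
        (A.toContinuousLinearEquiv : EuclideanSpace ℝ (Fin 4) →L[ℝ] EuclideanSpace ℝ (Fin 4)).comp
          (fderiv ℝ inversion y) :=
      ((A.toContinuousLinearEquiv : EuclideanSpace ℝ (Fin 4) →L[ℝ]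
        EuclideanSpace ℝ (Fin 4)).hasFDerivAt.comp y hι.hasFDerivAt).fderiv
    rw [h1]
    change κ • (fderiv ℝ (fun z => (A.toContinuousLinearEquiv :
        EuclideanSpace ℝ (Fin 4) →L[ℝ] EuclideanSpace ℝ (Fin 4)) (inversion z)) y v) = _
    rw [h2, ContinuousLinearMap.comp_apply]
    simp
  -- bilinearity of `ω_std` in the scale `κ`
  have hωκ : ∀ a b : EuclideanSpace ℝ (Fin 4),
      stdSymplecticForm (κ • a) (κ • b) = κ ^ 2 * stdSymplecticForm a b := by
    intro a b
    simp only [Literature.Geometry.Symplectic.stdSymplecticForm, PiLp.smul_apply, smul_eq_mul]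
    ring
  -- the compatibility of the two germs on the annulus `1 - δ₁ < ‖y‖ < 1` (ROUND)
  have hcompat : ∀ y : EuclideanSpace ℝ (Fin 4), 1 - δ₁ < ‖y‖ → ‖y‖ < 1 →
      ∀ v w : EuclideanSpace ℝ (Fin 4),
        Ω ((J ∘ e) y) ![mfderiv (𝓡 4) (𝓡 4) (J ∘ e) y v, mfderiv (𝓡 4) (𝓡 4) (J ∘ e) y w] =
          stdSymplecticForm (mfderiv (𝓡 4) 𝓘(ℝ, EuclideanSpace ℝ (Fin 4)) (ψt ∘ e) y v)
            (mfderiv (𝓡 4) 𝓘(ℝ, EuclideanSpace ℝ (Fin 4)) (ψt ∘ e) y w) := by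
    intro y hy1 hy2 v w
    have hy0 : y ≠ 0 := by
      intro h; rw [h, norm_zero] at hy1; linarith
    rw [hψmf y hy0 hy2 v, hψmf y hy0 hy2 w, hωκ]
    exact hR y (by linarith) (by linarith) v w
  -- (d) the glued symplectic form on the punctured sphere (brick R1)
  obtain ⟨sf, hsm, hcl, hnd, hsfψ⟩ := helper_puncturedGluedForm S.carrier e X Ω J U ψt δ₁ he hΩ hUo hΔU hJU
    hJbij hδ₁ hann hψs hψb hcompat
  -- (e) Gromov's recognition theorem relative to the end (route item, by name)
  have hL : Literature.Geometry.Symplectic.gromov_recognitionR4_relEnd := hG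
  haveI := Literature.Geometry.Symplectic.pathConnectedSpace_punctured_of_homotopySphere S (e 0)
  obtain ⟨Φ, -, K', hK'c, hΦψ⟩ := hL (punctured (e 0)) sf
    {x : punctured (e 0) | x.1 ∉ e '' Metric.ball (0 : EuclideanSpace ℝ (Fin 4)) 1} (κ / 1)
    (ψt ∘ Subtype.val) χ
    (Literature.Geometry.Symplectic.subsingleton_pi_two_punctured_of_homotopySphere S (e 0))
    hsm hcl hnd hcpt hψK hχ hbij hleft (fun x hx v w => hsfψ x (by simpa using hx) v w)
  -- (f) `Φ = ψ` on a punctured chart ball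
  obtain ⟨ρ₀, hρ₀, hρK⟩ := exists_ball_disjoint_of_isCompact he.contMDiff.continuous hK'c
  -- (g) the endgame (brick R3) with `L = κ • A`
  set L : EuclideanSpace ℝ (Fin 4) ≃L[ℝ] EuclideanSpace ℝ (Fin 4) :=
    A.toContinuousLinearEquiv.trans (ContinuousLinearEquiv.smulLeft (Units.mk0 κ hκ.ne')) with hLdef
  refine helper_sphere_of_diffeomorph_punctured_chartBall S.carrier e L (min ρ₀ 1) Φ he
    (lt_min hρ₀ one_pos) fun x y hxy hy => ?_
  have hy0 : y ≠ 0 := by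
    intro h
    exact (Literature.Geometry.Symplectic.mem_punctured.1 x.2) (by rw [hxy, h])
  have hxK : x ∉ K' := hρK x y hxy (lt_of_lt_of_le hy (min_le_left _ _))
  rw [hΦψ x hxK, Function.comp_apply, hxy, hψe y hy0 (lt_of_lt_of_le hy (min_le_right _ _))]
  simp [hLdef, Units.smul_def]

/-- **THE ROUND RUNG OF THE LINE: `GromovRecognitionRelEnd → STUB 1 → RoundSeam → SmoothPoincare4`.**
For a smooth `M ≃ₕ S⁴` (compact, orientable: a `HomotopySphere 4`), take a chart ball `e` (landed
`stub_chartEmbedding`), a rational host `(X, Ω, J)` of the fake ball (STUB 1 v2), a re-embedding `J'`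
with ROUND seam germ (`RoundSeam`), and conclude by the round-seam rung. [folklore] -/
theorem helper_smoothPoincare4_of_hostEmbedding_roundSeam :
    Summit.SmoothPoincare4.SmoothPoincare4.Theses.SymplecticOrigami.GromovRecognitionRelEnd → (∀ (S : Literature.Topology.FourManifolds.HomotopySphere 4) (e : EuclideanSpace ℝ (Fin 4) → S.carrier), Manifold.IsSmoothEmbedding (𝓡 4) (𝓡 4) ∞ e → ∃ (X : Type) (_ : TopologicalSpace X) (_ : T2Space X) (_ : SecondCountableTopology X) (_ : CompactSpace X) (_ : ChartedSpace (EuclideanSpace ℝ (Fin 4)) X) (_ : IsManifold (𝓡 4) ∞ X) (_ : SimplyConnectedSpace X) (Ω : Literature.Geometry.Kaehler.MForm (𝓡 4) X ℝ 2) (J : S.carrier → X), (Literature.Geometry.Kaehler.IsSmoothForm Ω ∧ Literature.Geometry.Kaehler.IsClosedForm Ω ∧ ∀ x (v : TangentSpace (𝓡 4) x), v ≠ 0 → ∃ w, Ω x ![v, w] ≠ 0) ∧ (∃ U : Set S.carrier, IsOpen U ∧ (e '' Metric.ball (0 : EuclideanSpace ℝ (Fin 4)) 1)ᶜ ⊆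 U ∧ ContMDiffOn (𝓡 4) (𝓡 4) ∞ J U ∧ Set.InjOn J U ∧ ∀ x ∈ U, Function.Bijective (mfderiv (𝓡 4) (𝓡 4) J x)) ∧ ((∃ c c' : (Metric.sphere (0 : EuclideanSpace ℝ (Fin 3)) 1) → X, (Manifold.IsSmoothEmbedding (𝓡 2) (𝓡 4) ∞ c ∧ (∀ y (v : TangentSpace (𝓡 2) y), v ≠ 0 → ∃ w : TangentSpace (𝓡 2) y, Ω (c y) ![mfderiv (𝓡 2) (𝓡 4) c y v, mfderiv (𝓡 2) (𝓡 4) c y w] ≠ 0) ∧ Manifold.IsSmoothEmbedding (𝓡 2) (𝓡 4) ∞ c' ∧ Disjoint (Set.range c) (Set.range c') ∧ ∃ H : unitInterval × (Metric.sphere (0 : EuclideanSpace ℝ (Fin 3)) 1) → X, Continuous H ∧ ∀ y, H (0, y) = c y ∧ H (1, y) = c' y)) ∨ (∃ (Ψ : X ≃ₘ⟮𝓡 4, 𝓡 4⟯ Literature.Topology.FourManifolds.ComplexProjectivePlane) (a : ℝ), 0 < a ∧ ∀ x (v w : TangentSpace (𝓡 4) x), Ω x ![v, w] = a * Literature.Geometry.Kaehler.CPn.fsForm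 2 (Ψ x) ![mfderiv (𝓡 4) (𝓡 4) Ψ x v, mfderiv (𝓡 4) (𝓡 4) Ψ x w]))) → (∀ (S : Literature.Topology.FourManifolds.HomotopySphere 4) (e : EuclideanSpace ℝ (Fin 4) → S.carrier) (X : Type) [TopologicalSpace X] [T2Space X] [SecondCountableTopology X] [CompactSpace X] [ChartedSpace (EuclideanSpace ℝ (Fin 4)) X] [IsManifold (𝓡 4) ∞ X] [SimplyConnectedSpace X] (Ω : Literature.Geometry.Kaehler.MForm (𝓡 4) X ℝ 2) (J : S.carrier → X), Manifold.IsSmoothEmbedding (𝓡 4) (𝓡 4) ∞ e → (Literature.Geometry.Kaehler.IsSmoothForm Ω ∧ Literature.Geometry.Kaehler.IsClosedForm Ω ∧ ∀ x (v : TangentSpace (𝓡 4) x), v ≠ 0 → ∃ w, Ω x ![v, w] ≠ 0) → (∃ U : Set S.carrier, IsOpen U ∧ (e '' Metric.ball (0 : EuclideanSpace ℝ (Fin 4)) 1)ᶜ ⊆ U ∧ ContMDiffOn (𝓡 4) (𝓡 4) ∞ J U ∧ Set.InjOn J U ∧ ∀ x ∈ U, Function.Bijective (mfderiv (𝓡 4)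 (𝓡 4) J x)) → ((∃ c c' : (Metric.sphere (0 : EuclideanSpace ℝ (Fin 3)) 1) → X, (Manifold.IsSmoothEmbedding (𝓡 2) (𝓡 4) ∞ c ∧ (∀ y (v : TangentSpace (𝓡 2) y), v ≠ 0 → ∃ w : TangentSpace (𝓡 2) y, Ω (c y) ![mfderiv (𝓡 2) (𝓡 4) c y v, mfderiv (𝓡 2) (𝓡 4) c y w] ≠ 0) ∧ Manifold.IsSmoothEmbedding (𝓡 2) (𝓡 4) ∞ c' ∧ Disjoint (Set.range c) (Set.range c') ∧ ∃ H : unitInterval × (Metric.sphere (0 : EuclideanSpace ℝ (Fin 3)) 1) → X, Continuous H ∧ ∀ y, H (0, y) = c y ∧ H (1, y) = c' y)) ∨ (∃ (Ψ : X ≃ₘ⟮𝓡 4, 𝓡 4⟯ Literature.Topology.FourManifolds.ComplexProjectivePlane) (a : ℝ), 0 < a ∧ ∀ x (v w : TangentSpace (𝓡 4) x), Ω x ![v, w] = a * Literature.Geometry.Kaehler.CPn.fsForm 2 (Ψ x) ![mfderiv (𝓡 4) (𝓡 4) Ψ x v, mfderiv (𝓡 4) (𝓡 4) Ψ x w]))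 → ∃ (J' : S.carrier → X) (κ : ℝ) (A : EuclideanSpace ℝ (Fin 4) ≃ₗᵢ[ℝ] EuclideanSpace ℝ (Fin 4)) (δ : ℝ), (∃ U : Set S.carrier, IsOpen U ∧ (e '' Metric.ball (0 : EuclideanSpace ℝ (Fin 4)) 1)ᶜ ⊆ U ∧ ContMDiffOn (𝓡 4) (𝓡 4) ∞ J' U ∧ Set.InjOn J' U ∧ ∀ x ∈ U, Function.Bijective (mfderiv (𝓡 4) (𝓡 4) J' x)) ∧ 0 < κ ∧ 0 < δ ∧ ∀ y : EuclideanSpace ℝ (Fin 4), 1 - δ < ‖y‖ → ‖y‖ < 1 + δ → ∀ v w : EuclideanSpace ℝ (Fin 4), Ω ((J' ∘ e) y) ![mfderiv (𝓡 4) (𝓡 4) (J' ∘ e) y v, mfderiv (𝓡 4) (𝓡 4) (J' ∘ e) y w] = κ ^ 2 * Literature.Geometry.Symplectic.stdSymplecticForm (A (fderiv ℝ Literature.Geometry.Symplectic.inversion y v)) (A (fderiv ℝ Literature.Geometry.Symplectic.inversion y w))) → _root_.SmoothPoincare4 := by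
  intro hG h1 h2
  unfold _root_.SmoothPoincare4 Literature.SPC4.SmoothPoincareConjectureFour
    ContinuousMap.HomotopyEquiv.NonemptyDiffeomorphSphere
  intro M _ _ _ _ _ hM
  haveI : CompactSpace M :=
    Literature.Topology.FourManifolds.compactSpace_of_homotopyEquiv_sphere_four_holds M hM
  obtain ⟨o⟩ :=
    Literature.Topology.FourManifolds.isOrientable_of_homotopyEquiv_sphere_four_holds M hM
  let S : HomotopySphere 4 := ⟨M, o, ⟨hM⟩⟩
  obtain ⟨e, he⟩ :=
    Summit.SmoothPoincare4.SmoothPoincare4.Theorems.OrigamiFoldExistence.RoundTraceContinuity.stub_chartEmbedding S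
  obtain ⟨X, _, _, _, _, _, _, _, Ω, J, hΩ, hJ, hX⟩ := h1 S e he
  obtain ⟨J', κ, A, δ, hJ', hκ, hδ, hR⟩ := h2 S e X Ω J he hΩ hJ hX
  exact helper_roundSeamRigidity_of_gromovRecognitionRelEnd hG S e X Ω J' he hΩ hJ' hX
    ⟨κ, A, δ, hκ, hδ, hR⟩

/-- NON-VACUITY of the round-seam rung's hypotheses (brick R0, p163435): the full package — chart
ball, symplectic rational host, fake-ball-neighbourhood embedding, ROUND seam germ — is inhabited at
`S = S⁴` in the host `S² × S²` (antipodal stereographic transition `4L ∘ ι`, Darboux polydisc).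
[folklore] -/
example : ∃ (S : HomotopySphere 4) (e : EuclideanSpace ℝ (Fin 4) → S.carrier), Manifold.IsSmoothEmbedding (𝓡 4) (𝓡 4) ∞ e :=
  let ⟨S, e, _, _, _, _, _, _, _, _, _, _, _, _, _, _, he, _⟩ := helper_roundSeamHypotheses_inhabited
  ⟨S, e, he⟩

end Summit.SmoothPoincare4.SmoothPoincare4.Theorems.OrigamiFoldExistence.StableSeamHost

end
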